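import Summits.Ventures.LatticeQCDFlow.Scaling.GraphSchemeSharpLaw
import Summits.Ventures.LatticeQCDFlow.Scaling.CompleteGraphWilsonMode

/-!
HONEST FRAMING: exact (Metropolis-corrected) sampling algorithms for lattice gauge theory; figures
of merit are autocorrelation/cost numbers at stated couplings and volumes; no continuum-physics
claim.

# HubListsSharpLaw — THE STAR AND THE COMPLETE LIST IN CLOSED FORM: WITH THE TWO-VALUE GROUND STATE `(x, 1, …, 1)` THE SHARP LAW OF FILE 4 READS
# **`((1−ρ)/ρ)·log((1−ν(u))·K/(4√(K+1))) ≤ t_mix(1/4) ≤ ⌈(1/ρ)·log(4h/ρ)⌉`** — THE FLOOR'S LOGARITHM IS `½·log K` ON BOTH TOPOLOGIES (chapter AH file 10's open point), uniformly in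
# `t` and `h`; law-free ceilings `⌈U·log(4hU)⌉` with `U = (K+1)(h+2t)/(ht)` (star) and `U = (K+1)(h + 4t/(K+1))/(h·2t/(K+1))` (complete list) (lean-2 GEN-48, ours)

Venture-side (OURS).  Cell `lqcd-flow` (pub-lqcd), unit `pub-lqcd-lean-2-g48`, 2026-08-31.  Chapter AI (the sizes of the Robin ground state), file 5 — parents AI4 `GraphSchemeSharpLaw`, AH10
`CompleteGraphWilsonMode` (and AH3 `StarWilsonMode` through it).  For the uniform hub list (`c` copies of each hub edge, `m = cK`) and the complete list (every pair `c` times, `2m =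
cK(K+1)`) chapter AH computed the ground state `c = (x, 1, …, 1)` with the scalar equations `t(1−x)(K+x) = hKx` resp. `(2t/(K+1))(1−x)(K+x) = hKx`; there the floor's logarithm carried
`√((t+h)/ρ)` (star) — degenerate as `h/t → 0` or `∞` — resp. was `O(1)` (complete list).  File 4's `D² = Σc² = x² + K` and `Σc = x + K` give `(x+K)/√(x²+K) ≥ K/√(K+1)` for every
`x ∈ (0,1)`: **the floor `((1−ρ)/ρ)·log((1−ν(u))K/(4√(K+1)))` holds on both topologies, uniformly in the rates**, next to the ceiling `⌈(1/ρ)·log(4h/ρ)⌉` (`= ⌈(1/ρ)·log(4(K+x)/x)⌉`,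
AH10's); with AH3 ∕ AH10's windows `max{K/t, (K+1)/h} ≤ 1/ρ ≤ (K+1)(h+2t)/(ht)` resp. `max{K(K+1)/(2t), (K+1)/h} ≤ 1/ρ ≤ …` both hub topologies are
**`Θ(max{transport, (K+1)/h}·log K)` TWO-SIDED INCLUDING THE LOGARITHM**, transport `K/t` (star) ∕ `K(K+1)/(2t)` (complete).  No definitions.

* §1 `twoValue_sums`, `twoValue_participation_ge`, `floorLog_mono`, `ceilLog_mono`; §2 `homStar_sharp_two_sided_mode`, `homStar_sharp_two_sided`; §3 `completeGraph_sharp_two_sided_mode`,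
  `completeGraph_sharp_two_sided`.

Literature grade (cell rule): OWN; nothing cited; no new bib keys.
-/

noncomputable section

open Finset Function Real
open Literature.Probability.MarkovChains

namespace Summit.Ventures.LatticeQCDFlow.Scaling

variable {S : Type*} [Fintype S] [DecidableEq S] {K m : ℕ} {ν : S → ℝ} {M : Fin (K + 1) → S → S → ℝ} {w : Fin (K + 1) → ℝ} {t : ℝ}
  {P : (Fin (K + 1) → S) → (Fin (K + 1) → S) → ℝ}

/-! ## §1 The two-value vector -/

omit [Fintype S] [DecidableEq S] in
/-- The sums of the two-value vector `c_0 = x`, `c_{k+1} = 1`: `Σc = x + K`, `Σc² = x² + K`. [ours] -/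
theorem twoValue_sums {c : Fin (K + 1) → ℝ} {x : ℝ} (hc0 : c 0 = x) (hck : ∀ i : Fin K, c i.succ = 1) :
    ∑ k : Fin (K + 1), c k = x + K ∧ ∑ k : Fin (K + 1), c k ^ 2 = x ^ 2 + K := by
  constructor
  · rw [Fin.sum_univ_succ, hc0]; simp_rw [hck]; simp
  · rw [Fin.sum_univ_succ, hc0]; simp_rw [hck]; simp

omit [Fintype S] [DecidableEq S] in
/-- **The participation of the two-value vector:** `K/√(K+1) ≤ (x+K)/√(x²+K)` for `0 < x < 1`. [ours] -/
theorem twoValue_participation_ge {x : ℝ} (hx0 : 0 < x) (hx1 : x < 1) (K : ℕ) :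
    (K : ℝ) / Real.sqrt ((K : ℝ) + 1) ≤ (x + K) / Real.sqrt (x ^ 2 + K) := by
  have hK0 : (0 : ℝ) ≤ K := Nat.cast_nonneg K
  have h1 : 0 < Real.sqrt ((K : ℝ) + 1) := Real.sqrt_pos.mpr (by linarith)
  have h2 : 0 < Real.sqrt (x ^ 2 + K) := Real.sqrt_pos.mpr (by positivity)
  rw [div_le_div_iff₀ h1 h2]
  -- square both sides: `K²(x²+K) ≤ (x+K)²(K+1)`
  have hsq : (K : ℝ) ^ 2 * (x ^ 2 + K) ≤ (x + K) ^ 2 * ((K : ℝ) + 1) := by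
    nlinarith [mul_nonneg hK0 hx0.le, mul_nonneg (mul_nonneg hK0 hK0) hx0.le, sq_nonneg x, mul_nonneg hK0 (sq_nonneg x)]
  have hl : (K : ℝ) * Real.sqrt (x ^ 2 + K) = Real.sqrt ((K : ℝ) ^ 2 * (x ^ 2 + K)) := by
    rw [Real.sqrt_mul (sq_nonneg _), Real.sqrt_sq hK0]
  have hr : (x + K) * Real.sqrt ((K : ℝ) + 1) = Real.sqrt ((x + K) ^ 2 * ((K : ℝ) + 1)) := by
    rw [Real.sqrt_mul (sq_nonneg _), Real.sqrt_sq (by linarith)]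
  rw [hl, hr]
  exact Real.sqrt_le_sqrt hsq

omit [Fintype S] [DecidableEq S] in
/-- Monotonicity of the floor in its logarithm's argument: `0 ≤ κ`, `0 < A ≤ B` ⇒ `κ·log A ≤ κ·log B`. [ours] -/
theorem floorLog_mono {κ A B : ℝ} (hκ : 0 ≤ κ) (hA : 0 < A) (hAB : A ≤ B) : κ * Real.log A ≤ κ * Real.log B :=
  mul_le_mul_of_nonneg_left (Real.log_le_log hA hAB) hκ

omit [Fintype S] [DecidableEq S] in
/-- Monotonicity of the ceiling `⌈U·log(aU)⌉` in `U`: `0 < V ≤ U`, `1 ≤ aV` ⇒ `⌈V·log(aV)⌉ ≤ ⌈U·log(aU)⌉`. [ours] -/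
theorem ceilLog_mono {a U V : ℝ} (hV : 0 < V) (hVU : V ≤ U) (haV : 1 ≤ a * V) : ⌈V * Real.log (a * V)⌉₊ ≤ ⌈U * Real.log (a * U)⌉₊ := by
  have ha : 0 < a := by
    by_contra h; push Not at h; nlinarith
  refine Nat.ceil_mono ?_
  have hlogV : 0 ≤ Real.log (a * V) := Real.log_nonneg haV
  calc V * Real.log (a * V) ≤ U * Real.log (a * V) := mul_le_mul_of_nonneg_right hVU hlogV
    _ ≤ U * Real.log (a * U) := mul_le_mul_of_nonneg_left (Real.log_le_log (by positivity) (mul_le_mul_of_nonneg_left hVU ha.le)) (by linarith)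

/-! ## §2 The star -/

section Star
variable (κ : Fin m → Fin K)

/-- **THE STAR IN CLOSED FORM AT ITS MODE:** uniform hub list (`c ≥ 1` copies of each hub edge, `m = cK`), `K ≥ 1`, `0 < t < 1`, `w_0 > 0`, `h = (1−t)w_0`, one positive law, exact hot
sampler, idle cold kernels, `x ∈ (0,1)` a root of `t(1−x)(K+x) = hKx`, `ρ = t(1−x)/K`; then for every content `u`:
**`((1−ρ)/ρ)·log((1−ν(u))·K/(4√(K+1))) ≤ t_mix(1/4) ≤ ⌈(1/ρ)·log(4h/ρ)⌉`**. [ours] -/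
theorem homStar_sharp_two_sided_mode (hK : 1 ≤ K) (hm : 1 ≤ m) {cc : ℕ} (hcc : 1 ≤ cc) (hunif : ∀ i : Fin K, (univ.filter fun r : Fin m => κ r = i).card = cc)
    (hmc : m = cc * K) (hν : ∀ v, 0 < ν v) (hν1 : ∑ v, ν v = 1) (hM0 : ∀ u v, M 0 u v = ν v) (hidle : ∀ i : Fin K, ∀ u v, M i.succ u v = if v = u then 1 else 0)
    (hw0 : ∀ k, 0 ≤ w k) (hw00 : 0 < w 0) (hw1 : ∑ k, w k = 1) (ht0 : 0 < t) (ht1 : t < 1)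
    (hP : ∀ x y, P x y = t * ptGraphSwap (fun _ : Fin (K + 1) => ν) (fun r : Fin m => (((0 : Fin (K + 1)), (κ r).succ) : Fin (K + 1) × Fin (K + 1))) (fun _ => Equiv.refl S) x y
      + (1 - t) * prodKernel w M x y)
    {x ρ : ℝ} (hx0 : 0 < x) (hx1 : x < 1) (hx : t * (1 - x) * (K + x) = (1 - t) * w 0 * K * x) (hρ : ρ = t * (1 - x) / K) (u : S) :
    (1 - ρ) / ρ * Real.log ((1 - ν u) * K / (4 * Real.sqrt ((K : ℝ) + 1))) ≤ (mixingTime P (tensorFun (fun _ : Fin (K + 1) => ν)) (1 / 4) : ℝ)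
      ∧ mixingTime P (tensorFun (fun _ : Fin (K + 1) => ν)) (1 / 4) ≤ ⌈1 / ρ * Real.log (4 * ((1 - t) * w 0) / ρ)⌉₊ := by
  have hKpos : (0 : ℝ) < K := Nat.cast_pos.mpr (by omega)
  have hhh : 0 < (1 - t) * w 0 := mul_pos (by linarith) hw00
  obtain ⟨_, hρ0, _, hρh, _⟩ := starMode_rho_bounds hK ht0 hhh hx0 hx1 hx hρ
  have hρ1 : ρ < 1 := by
    have hw01 : w 0 ≤ 1 := by
      calc w 0 ≤ ∑ k, w k := Finset.single_le_sum (fun k _ => hw0 k) (mem_univ 0)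
        _ = 1 := hw1
    have : (1 - t) * w 0 / ((K : ℝ) + 1) ≤ (1 - t) * w 0 := div_le_self hhh.le (by linarith)
    nlinarith
  -- the two-value vector
  set c : Fin (K + 1) → ℝ := fun k => if k = 0 then x else 1 with hc
  have hc0 : c 0 = x := by rw [hc]; simp
  have hck : ∀ i : Fin K, c i.succ = 1 := fun i => by rw [hc]; simp [Fin.succ_ne_zero]
  have hcpos : ∀ k, 0 < c k := fun k => by rw [hc]; dsimp only; split_ifs <;> linarith
  have he : ∀ r : Fin m, ((fun r : Fin m => (((0 : Fin (K + 1)), (κ r).succ) : Fin (K + 1) × Fin (K + 1))) r).1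
      ≠ ((fun r : Fin m => (((0 : Fin (K + 1)), (κ r).succ) : Fin (K + 1) × Fin (K + 1))) r).2 := fun r => (Fin.succ_ne_zero (κ r)).symm
  have hvertex0 := star_vertex_equations κ (t := t) hK hcc hunif hmc hc0 hck hρ hx
  have hvertex : ∀ k : Fin (K + 1), t / m * ∑ r : Fin m,
      ((if k = ((fun r : Fin m => (((0 : Fin (K + 1)), (κ r).succ) : Fin (K + 1) × Fin (K + 1))) r).1
        then c ((fun r : Fin m => (((0 : Fin (K + 1)), (κ r).succ) : Fin (K + 1) × Fin (K + 1))) r).2 - c ((fun r : Fin m => (((0 : Fin (K + 1)), (κ r).succ) : Fin (K + 1) × Fin (K + 1))) r).1 else 0)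
      + (if k = ((fun r : Fin m => (((0 : Fin (K + 1)), (κ r).succ) : Fin (K + 1) × Fin (K + 1))) r).2
        then c ((fun r : Fin m => (((0 : Fin (K + 1)), (κ r).succ) : Fin (K + 1) × Fin (K + 1))) r).1 - c ((fun r : Fin m => (((0 : Fin (K + 1)), (κ r).succ) : Fin (K + 1) × Fin (K + 1))) r).2 else 0))
      - (if k = 0 then (1 - t) * w 0 * c k else 0) = -ρ * c k := by
    intro k
    have := hvertex0 k
    by_cases hk : k = 0
    · subst hk; exact this
    · rw [if_neg hk] at this ⊢; exact this
  have htwo := graphScheme_sharp_two_sided_mode (fun r : Fin m => (((0 : Fin (K + 1)), (κ r).succ) : Fin (K + 1) × Fin (K + 1))) hm he hν hν1 hM0 hidle hw0 hw00 hw1 ht0 ht1 hP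
    hρ0 hcpos hvertex u
  obtain ⟨hs1, hs2⟩ := twoValue_sums hc0 hck
  rw [hs1, hs2] at htwo
  refine ⟨le_trans ?_ htwo.1, htwo.2⟩
  -- the floor's logarithm: `(1−ν(u))K/(4√(K+1)) ≤ (1−ν(u))(x+K)/(4√(x²+K))`
  have hνu : ν u ≤ 1 := by
    calc ν u ≤ ∑ v, ν v := Finset.single_le_sum (fun v _ => (hν v).le) (mem_univ u)
      _ = 1 := hν1
  have hcoef : 0 ≤ (1 - ρ) / ρ := div_nonneg (by linarith) hρ0.le
  rcases eq_or_lt_of_le hνu with heq | hlt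
  · rw [heq]; simp
  · have hA : 0 < (1 - ν u) * K / (4 * Real.sqrt ((K : ℝ) + 1)) := by
      have : 0 < Real.sqrt ((K : ℝ) + 1) := Real.sqrt_pos.mpr (by linarith)
      have : 0 < 1 - ν u := by linarith
      positivity
    refine floorLog_mono hcoef hA ?_
    have hpart := twoValue_participation_ge hx0 hx1 K
    have h4 : (1 - ν u) * K / (4 * Real.sqrt ((K : ℝ) + 1)) = (1 - ν u) / 4 * ((K : ℝ) / Real.sqrt ((K : ℝ) + 1)) := by ring
    have h5 : (1 - ν u) * (x + K) / (4 * Real.sqrt (x ^ 2 + K)) = (1 - ν u) / 4 * ((x + K) / Real.sqrt (x ^ 2 + K)) := by ring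
    rw [h4, h5]
    exact mul_le_mul_of_nonneg_left hpart (by linarith)

/-- **THE HOMOGENEOUS REPLICA-EXCHANGE STAR IS `Θ(max{K/t, (K+1)/h}·log K)` TWO-SIDED INCLUDING THE LOGARITHM, LAW-FREE** (hypotheses of the mode form, no root needed): there is `ρ` with
`max{K/t, (K+1)/h} ≤ 1/ρ ≤ (K+1)(h+2t)/(ht)` and, for every content `u`,
**`((1−ρ)/ρ)·log((1−ν(u))K/(4√(K+1))) ≤ t_mix(1/4) ≤ ⌈(1/ρ)·log(4h/ρ)⌉ ≤ ⌈U·log(4hU)⌉`, `U = (K+1)(h+2t)/(ht)`**. [ours] -/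
theorem homStar_sharp_two_sided (hK : 1 ≤ K) (hm : 1 ≤ m) {cc : ℕ} (hcc : 1 ≤ cc) (hunif : ∀ i : Fin K, (univ.filter fun r : Fin m => κ r = i).card = cc)
    (hmc : m = cc * K) (hν : ∀ v, 0 < ν v) (hν1 : ∑ v, ν v = 1) (hM0 : ∀ u v, M 0 u v = ν v) (hidle : ∀ i : Fin K, ∀ u v, M i.succ u v = if v = u then 1 else 0)
    (hw0 : ∀ k, 0 ≤ w k) (hw00 : 0 < w 0) (hw1 : ∑ k, w k = 1) (ht0 : 0 < t) (ht1 : t < 1)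
    (hP : ∀ x y, P x y = t * ptGraphSwap (fun _ : Fin (K + 1) => ν) (fun r : Fin m => (((0 : Fin (K + 1)), (κ r).succ) : Fin (K + 1) × Fin (K + 1))) (fun _ => Equiv.refl S) x y
      + (1 - t) * prodKernel w M x y) (u : S) :
    ∃ ρ : ℝ, 0 < ρ ∧ (K : ℝ) / t ≤ 1 / ρ ∧ ((K : ℝ) + 1) / ((1 - t) * w 0) ≤ 1 / ρ ∧ 1 / ρ ≤ ((K : ℝ) + 1) * ((1 - t) * w 0 + 2 * t) / ((1 - t) * w 0 * t) ∧
      (1 - ρ) / ρ * Real.log ((1 - ν u) * K / (4 * Real.sqrt ((K : ℝ) + 1))) ≤ (mixingTime P (tensorFun (fun _ : Fin (K + 1) => ν)) (1 / 4) : ℝ) ∧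
      mixingTime P (tensorFun (fun _ : Fin (K + 1) => ν)) (1 / 4) ≤ ⌈1 / ρ * Real.log (4 * ((1 - t) * w 0) / ρ)⌉₊ ∧
      ⌈1 / ρ * Real.log (4 * ((1 - t) * w 0) / ρ)⌉₊
        ≤ ⌈((K : ℝ) + 1) * ((1 - t) * w 0 + 2 * t) / ((1 - t) * w 0 * t) * Real.log (4 * ((1 - t) * w 0) * (((K : ℝ) + 1) * ((1 - t) * w 0 + 2 * t) / ((1 - t) * w 0 * t)))⌉₊ := by
  have hKpos : (0 : ℝ) < K := Nat.cast_pos.mpr (by omega)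
  have hK1 : (1 : ℝ) ≤ K := by exact_mod_cast hK
  set hh : ℝ := (1 - t) * w 0 with hhdef
  have hhh : 0 < hh := mul_pos (by linarith) hw00
  obtain ⟨x, hx0, hx1, hx⟩ := starMode_exists hK ht0 hhh
  set ρ : ℝ := t * (1 - x) / K with hρ
  obtain ⟨_, hρ0, hρt, hρh, hinv⟩ := starMode_rho_bounds hK ht0 hhh hx0 hx1 hx hρ
  have htwo := homStar_sharp_two_sided_mode κ hK hm hcc hunif hmc hν hν1 hM0 hidle hw0 hw00 hw1 ht0 ht1 hP hx0 hx1 hx hρ u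
  refine ⟨ρ, hρ0, ?_, ?_, hinv, htwo.1, htwo.2, ?_⟩
  · rw [div_le_div_iff₀ ht0 hρ0, one_mul]
    calc (K : ℝ) * ρ ≤ K * (t / K) := mul_le_mul_of_nonneg_left hρt hKpos.le
      _ = t := by field_simp
  · rw [div_le_div_iff₀ hhh hρ0, one_mul]
    calc ((K : ℝ) + 1) * ρ ≤ ((K : ℝ) + 1) * (hh / ((K : ℝ) + 1)) := mul_le_mul_of_nonneg_left hρh (by linarith)
      _ = hh := by field_simp
  · have h1 : 1 / ρ * Real.log (4 * hh / ρ) = 1 / ρ * Real.log (4 * hh * (1 / ρ)) := by rw [mul_one_div]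
    rw [h1]
    refine ceilLog_mono (by positivity) hinv ?_
    -- `1 ≤ 4h/ρ` from `ρ ≤ h/(K+1) ≤ h`
    have : ρ ≤ hh := le_trans hρh (div_le_self hhh.le (by linarith))
    rw [mul_one_div, le_div_iff₀ hρ0]; linarith

end Star

/-! ## §3 The complete list -/

section Complete
variable (e : Fin m → Fin (K + 1) × Fin (K + 1))

/-- **THE COMPLETE LIST IN CLOSED FORM AT ITS MODE:** every pair listed `c ≥ 1` times (`2m = cK(K+1)`), `K ≥ 1`, `0 < t < 1`, `w_0 > 0`, `h = (1−t)w_0`, one positive law, exact hot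
sampler, idle cold kernels, `x ∈ (0,1)` a root of `(2t/(K+1))(1−x)(K+x) = hKx`, `ρ = 2t(1−x)/(K(K+1))`; then for every content `u`:
**`((1−ρ)/ρ)·log((1−ν(u))·K/(4√(K+1))) ≤ t_mix(1/4) ≤ ⌈(1/ρ)·log(4h/ρ)⌉`** — the floor now carries `½·log K` (AH10's was `O(1)`). [ours] -/
theorem completeGraph_sharp_two_sided_mode (hK : 1 ≤ K) (hm : 1 ≤ m) (he : ∀ r, (e r).1 ≠ (e r).2) {cc : ℕ} (hcc : 1 ≤ cc)
    (hcomplete : ∀ k l : Fin (K + 1), k ≠ l → (univ.filter fun r : Fin m => ((e r).1 = k ∧ (e r).2 = l) ∨ ((e r).2 = k ∧ (e r).1 = l)).card = cc)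
    (hmc : (m : ℝ) * 2 = cc * K * ((K : ℝ) + 1)) (hν : ∀ v, 0 < ν v) (hν1 : ∑ v, ν v = 1) (hM0 : ∀ u v, M 0 u v = ν v)
    (hidle : ∀ i : Fin K, ∀ u v, M i.succ u v = if v = u then 1 else 0) (hw0 : ∀ k, 0 ≤ w k) (hw00 : 0 < w 0) (hw1 : ∑ k, w k = 1) (ht0 : 0 < t) (ht1 : t < 1)
    (hP : ∀ x y, P x y = t * ptGraphSwap (fun _ : Fin (K + 1) => ν) e (fun _ => Equiv.refl S) x y + (1 - t) * prodKernel w M x y)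
    {x ρ : ℝ} (hx0 : 0 < x) (hx1 : x < 1) (hx : 2 * t / ((K : ℝ) + 1) * (1 - x) * (K + x) = (1 - t) * w 0 * K * x) (hρ : ρ = 2 * t / ((K : ℝ) + 1) * (1 - x) / K) (u : S) :
    (1 - ρ) / ρ * Real.log ((1 - ν u) * K / (4 * Real.sqrt ((K : ℝ) + 1))) ≤ (mixingTime P (tensorFun (fun _ : Fin (K + 1) => ν)) (1 / 4) : ℝ)
      ∧ mixingTime P (tensorFun (fun _ : Fin (K + 1) => ν)) (1 / 4) ≤ ⌈1 / ρ * Real.log (4 * ((1 - t) * w 0) / ρ)⌉₊ := by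
  have hKpos : (0 : ℝ) < K := Nat.cast_pos.mpr (by omega)
  have hhh : 0 < (1 - t) * w 0 := mul_pos (by linarith) hw00
  obtain ⟨_, hρ0, _, hρh, _⟩ := completeGraph_rho_bounds hK ht0 hhh hx0 hx1 hx hρ
  have hρ1 : ρ < 1 := by
    have hw01 : w 0 ≤ 1 := by
      calc w 0 ≤ ∑ k, w k := Finset.single_le_sum (fun k _ => hw0 k) (mem_univ 0)
        _ = 1 := hw1
    have : (1 - t) * w 0 / ((K : ℝ) + 1) ≤ (1 - t) * w 0 := div_le_self hhh.le (by linarith)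
    nlinarith
  set c : Fin (K + 1) → ℝ := fun k => if k = 0 then x else 1 with hc
  have hc0 : c 0 = x := by rw [hc]; simp
  have hck : ∀ i : Fin K, c i.succ = 1 := fun i => by rw [hc]; simp [Fin.succ_ne_zero]
  have hcpos : ∀ k, 0 < c k := fun k => by rw [hc]; dsimp only; split_ifs <;> linarith
  have hvertex0 := complete_vertex_equations e (t := t) hK he hcc hcomplete hmc hc0 hck hρ hx
  have hvertex : ∀ k : Fin (K + 1), t / m * ∑ r : Fin m, ((if k = (e r).1 then c (e r).2 - c (e r).1 else 0) + (if k = (e r).2 then c (e r).1 - c (e r).2 else 0))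
      - (if k = 0 then (1 - t) * w 0 * c k else 0) = -ρ * c k := by
    intro k
    have := hvertex0 k
    by_cases hk : k = 0
    · subst hk; exact this
    · rw [if_neg hk] at this ⊢; exact this
  have htwo := graphScheme_sharp_two_sided_mode e hm he hν hν1 hM0 hidle hw0 hw00 hw1 ht0 ht1 hP hρ0 hcpos hvertex u
  obtain ⟨hs1, hs2⟩ := twoValue_sums hc0 hck
  rw [hs1, hs2] at htwo
  refine ⟨le_trans ?_ htwo.1, htwo.2⟩
  have hνu : ν u ≤ 1 := by
    calc ν u ≤ ∑ v, ν v := Finset.single_le_sum (fun v _ => (hν v).le) (mem_univ u)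
      _ = 1 := hν1
  have hcoef : 0 ≤ (1 - ρ) / ρ := div_nonneg (by linarith) hρ0.le
  rcases eq_or_lt_of_le hνu with heq | hlt
  · rw [heq]; simp
  · have hA : 0 < (1 - ν u) * K / (4 * Real.sqrt ((K : ℝ) + 1)) := by
      have : 0 < Real.sqrt ((K : ℝ) + 1) := Real.sqrt_pos.mpr (by linarith)
      have : 0 < 1 - ν u := by linarith
      positivity
    refine floorLog_mono hcoef hA ?_
    have hpart := twoValue_participation_ge hx0 hx1 K
    have h4 : (1 - ν u) * K / (4 * Real.sqrt ((K : ℝ) + 1)) = (1 - ν u) / 4 * ((K : ℝ) / Real.sqrt ((K : ℝ) + 1)) := by ring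
    have h5 : (1 - ν u) * (x + K) / (4 * Real.sqrt (x ^ 2 + K)) = (1 - ν u) / 4 * ((x + K) / Real.sqrt (x ^ 2 + K)) := by ring
    rw [h4, h5]
    exact mul_le_mul_of_nonneg_left hpart (by linarith)

/-- **THE HOMOGENEOUS SCHEME ON THE COMPLETE LIST IS `Θ(max{K(K+1)/(2t), (K+1)/h}·log K)` TWO-SIDED INCLUDING THE LOGARITHM, LAW-FREE** (hypotheses of the mode form, no root needed):
there is `ρ` with `max{K(K+1)/(2t), (K+1)/h} ≤ 1/ρ ≤ (K+1)(h + 4t/(K+1))/(h·(2t/(K+1)))` and, for every content `u`,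
**`((1−ρ)/ρ)·log((1−ν(u))K/(4√(K+1))) ≤ t_mix(1/4) ≤ ⌈(1/ρ)·log(4h/ρ)⌉ ≤ ⌈U·log(4hU)⌉`, `U = (K+1)(h + 2·(2t/(K+1)))/(h·(2t/(K+1)))`**. [ours] -/
theorem completeGraph_sharp_two_sided (hK : 1 ≤ K) (hm : 1 ≤ m) (he : ∀ r, (e r).1 ≠ (e r).2) {cc : ℕ} (hcc : 1 ≤ cc)
    (hcomplete : ∀ k l : Fin (K + 1), k ≠ l → (univ.filter fun r : Fin m => ((e r).1 = k ∧ (e r).2 = l) ∨ ((e r).2 = k ∧ (e r).1 = l)).card = cc)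
    (hmc : (m : ℝ) * 2 = cc * K * ((K : ℝ) + 1)) (hν : ∀ v, 0 < ν v) (hν1 : ∑ v, ν v = 1) (hM0 : ∀ u v, M 0 u v = ν v)
    (hidle : ∀ i : Fin K, ∀ u v, M i.succ u v = if v = u then 1 else 0) (hw0 : ∀ k, 0 ≤ w k) (hw00 : 0 < w 0) (hw1 : ∑ k, w k = 1) (ht0 : 0 < t) (ht1 : t < 1)
    (hP : ∀ x y, P x y = t * ptGraphSwap (fun _ : Fin (K + 1) => ν) e (fun _ => Equiv.refl S) x y + (1 - t) * prodKernel w M x y) (u : S) :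
    ∃ ρ : ℝ, 0 < ρ ∧ (K : ℝ) * ((K : ℝ) + 1) / (2 * t) ≤ 1 / ρ ∧ ((K : ℝ) + 1) / ((1 - t) * w 0) ≤ 1 / ρ ∧
      1 / ρ ≤ ((K : ℝ) + 1) * ((1 - t) * w 0 + 2 * (2 * t / ((K : ℝ) + 1))) / ((1 - t) * w 0 * (2 * t / ((K : ℝ) + 1))) ∧
      (1 - ρ) / ρ * Real.log ((1 - ν u) * K / (4 * Real.sqrt ((K : ℝ) + 1))) ≤ (mixingTime P (tensorFun (fun _ : Fin (K + 1) => ν)) (1 / 4) : ℝ) ∧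
      mixingTime P (tensorFun (fun _ : Fin (K + 1) => ν)) (1 / 4) ≤ ⌈1 / ρ * Real.log (4 * ((1 - t) * w 0) / ρ)⌉₊ ∧
      ⌈1 / ρ * Real.log (4 * ((1 - t) * w 0) / ρ)⌉₊
        ≤ ⌈((K : ℝ) + 1) * ((1 - t) * w 0 + 2 * (2 * t / ((K : ℝ) + 1))) / ((1 - t) * w 0 * (2 * t / ((K : ℝ) + 1)))
            * Real.log (4 * ((1 - t) * w 0) * (((K : ℝ) + 1) * ((1 - t) * w 0 + 2 * (2 * t / ((K : ℝ) + 1))) / ((1 - t) * w 0 * (2 * t / ((K : ℝ) + 1)))))⌉₊ := by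
  have hKpos : (0 : ℝ) < K := Nat.cast_pos.mpr (by omega)
  set hh : ℝ := (1 - t) * w 0 with hhdef
  have hhh : 0 < hh := mul_pos (by linarith) hw00
  obtain ⟨x, hx0, hx1, hx⟩ := starMode_exists (t := 2 * t / ((K : ℝ) + 1)) hK (by positivity) hhh
  set ρ : ℝ := 2 * t / ((K : ℝ) + 1) * (1 - x) / K with hρ
  obtain ⟨_, hρ0, hρt, hρh, hinv⟩ := completeGraph_rho_bounds hK ht0 hhh hx0 hx1 hx hρ
  have htwo := completeGraph_sharp_two_sided_mode e hK hm he hcc hcomplete hmc hν hν1 hM0 hidle hw0 hw00 hw1 ht0 ht1 hP hx0 hx1 hx hρ u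
  refine ⟨ρ, hρ0, ?_, ?_, hinv, htwo.1, htwo.2, ?_⟩
  · rw [div_le_div_iff₀ (by positivity) hρ0, one_mul]
    have := mul_le_mul_of_nonneg_left hρt (show (0 : ℝ) ≤ K * ((K : ℝ) + 1) by positivity)
    calc (K : ℝ) * ((K : ℝ) + 1) * ρ ≤ (K : ℝ) * ((K : ℝ) + 1) * (2 * t / ((K : ℝ) + 1) / K) := this
      _ = 2 * t := by field_simp
  · rw [div_le_div_iff₀ hhh hρ0, one_mul]
    calc ((K : ℝ) + 1) * ρ ≤ ((K : ℝ) + 1) * (hh / ((K : ℝ) + 1)) := mul_le_mul_of_nonneg_left hρh (by linarith)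
      _ = hh := by field_simp
  · have h1 : 1 / ρ * Real.log (4 * hh / ρ) = 1 / ρ * Real.log (4 * hh * (1 / ρ)) := by rw [mul_one_div]
    rw [h1]
    refine ceilLog_mono (by positivity) hinv ?_
    have : ρ ≤ hh := le_trans hρh (div_le_self hhh.le (by linarith))
    rw [mul_one_div, le_div_iff₀ hρ0]; linarith

end Complete

end Summit.Ventures.LatticeQCDFlow.Scaling

end
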